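import Mathlib

/-!
# Helper (positive, for the lead's `stub_entropyEnergy_alongFlow`): the Riccati comparison behind EE(K,4)

If `I ≥ 0` is continuous on `[0,T]` with right derivative `I'` satisfying the dimensional Bakry–Émery
inequality `I' ≤ -2K I - I²/2` (`K > 0`), then `I(t) ≤ 4K I₀ e^{-2Kt} / (4K + I₀ (1 - e^{-2Kt}))` and
`∫₀ᵀ I ≤ 2 log (1 + I₀/(4K))` (`I₀ = I 0`).  With `I` = Fisher information along the heat flow and `H' = -I`
this is exactly the closed form in `stub_entropyEnergy_alongFlow` (n = 4: `(n/2) log (1 + I₀/(ρ n))`).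
Pure one-variable calculus; Mathlib only.  drefute refuter-drefute-stmt-SmoothPoincare4-10871-0, 2026-08-16.
-/

open Set Real

namespace DrefuteRiccati

/-- A continuous function with nonpositive right derivative on `[a,b)` is non-increasing on `[a,b]`. -/
theorem le_of_deriv_right_nonpos {I I' : ℝ → ℝ} {a b : ℝ}
    (hcont : ContinuousOn I (Icc a b))
    (hder : ∀ t ∈ Ico a b, HasDerivWithinAt I (I' t) (Ici t) t)
    (hle : ∀ t ∈ Ico a b, I' t ≤ 0) {s t : ℝ} (hs : a ≤ s) (hst : s ≤ t) (ht : t ≤ b) :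
    I t ≤ I s := by
  have hcont' : ContinuousOn I (Icc s b) := hcont.mono (Icc_subset_Icc hs le_rfl)
  have key := image_le_of_deriv_right_le_deriv_boundary (f := I) (f' := I') (a := s) (b := b)
    (B := fun _ ↦ I s) (B' := fun _ ↦ 0) hcont'
    (fun x hx ↦ hder x ⟨hs.trans hx.1, hx.2⟩) (le_refl (I s))
    continuousOn_const (fun x _ ↦ hasDerivWithinAt_const x (Ici x) (I s))
    (fun x hx ↦ hle x ⟨hs.trans hx.1, hx.2⟩)
  exact key ⟨hst, ht⟩

/-- **Pointwise Riccati comparison.** -/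
theorem riccati_bound {K : ℝ} (hK : 0 < K) {I I' : ℝ → ℝ} {T : ℝ} (hT : 0 ≤ T)
    (hcont : ContinuousOn I (Icc 0 T))
    (hder : ∀ t ∈ Ico 0 T, HasDerivWithinAt I (I' t) (Ici t) t)
    (hineq : ∀ t ∈ Ico 0 T, I' t ≤ -2 * K * I t - (1 / 2) * I t ^ 2)
    (hnn : ∀ t ∈ Icc 0 T, 0 ≤ I t) {t : ℝ} (ht : t ∈ Icc 0 T) :
    I t ≤ 4 * K * I 0 * exp (-2 * K * t) / (4 * K + I 0 * (1 - exp (-2 * K * t))) := by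
  have _ := hT
  -- `I` is non-increasing
  have hI'np : ∀ s ∈ Ico 0 T, I' s ≤ 0 := by
    intro s hs
    have h1 := hineq s hs
    have h2 := hnn s ⟨hs.1, hs.2.le⟩
    nlinarith [sq_nonneg (I s)]
  have hanti : ∀ s u : ℝ, 0 ≤ s → s ≤ u → u ≤ T → I u ≤ I s :=
    fun s u hs hsu hu ↦ le_of_deriv_right_nonpos hcont hder hI'np hs hsu hu
  set I₀ : ℝ := I 0 with hI₀def
  have hI₀ : 0 ≤ I₀ := hnn 0 ⟨le_rfl, hT⟩
  set e : ℝ := exp (-2 * K * t) with hedef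
  have he_pos : 0 < e := exp_pos _
  have he_le : e ≤ 1 := by
    rw [hedef, exp_le_one_iff]
    nlinarith [ht.1]
  have hden : 0 < 4 * K + I₀ * (1 - e) := by
    have : 0 ≤ I₀ * (1 - e) := mul_nonneg hI₀ (by linarith)
    linarith
  by_cases h0 : I t = 0
  · rw [h0]
    exact div_nonneg (mul_nonneg (by positivity) he_pos.le) hden.le
  -- `I > 0` on `[0, t]`
  have hIt : 0 < I t := lt_of_le_of_ne (hnn t ht) (Ne.symm h0)
  have hIpos : ∀ s ∈ Icc 0 t, 0 < I s :=
    fun s hs ↦ hIt.trans_le (hanti s t hs.1 hs.2 ht.2)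
  have hI₀pos : 0 < I₀ := hIpos 0 ⟨le_rfl, ht.1⟩
  -- the transformed quantity `φ(s) = e^{-2Ks}/I(s) - (1 - e^{-2Ks})/(4K)` is non-decreasing on `[0,t]`
  set φ : ℝ → ℝ := fun s ↦ exp (-2 * K * s) * (I s)⁻¹ - (1 - exp (-2 * K * s)) / (4 * K) with hφdef
  set φ' : ℝ → ℝ := fun s ↦
    exp (-2 * K * s) * ((-2 * K * I s - I' s - (1 / 2) * I s ^ 2) / (I s) ^ 2) with hφ'def
  have hexp : ∀ s : ℝ, HasDerivAt (fun x ↦ exp (-2 * K * x)) (exp (-2 * K * s) * (-2 * K)) s := by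
    intro s
    have h := ((hasDerivAt_id s).const_mul (-2 * K)).exp
    simpa using h
  have hφder : ∀ s ∈ Ico 0 t, HasDerivWithinAt φ (φ' s) (Ici s) s := by
    intro s hs
    have hsT : s ∈ Ico 0 T := ⟨hs.1, hs.2.trans_le ht.2⟩
    have hIs : I s ≠ 0 := (hIpos s ⟨hs.1, hs.2.le⟩).ne'
    have h1 : HasDerivWithinAt (fun x ↦ exp (-2 * K * x) * (I x)⁻¹)
        (exp (-2 * K * s) * (-2 * K) * (I s)⁻¹ + exp (-2 * K * s) * (-(I' s) / (I s) ^ 2)) (Ici s) s :=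
      (hexp s).hasDerivWithinAt.mul ((hder s hsT).inv hIs)
    have h2 : HasDerivWithinAt (fun x ↦ (1 - exp (-2 * K * x)) / (4 * K))
        (-(exp (-2 * K * s) * (-2 * K)) / (4 * K)) (Ici s) s :=
      ((hexp s).hasDerivWithinAt.const_sub 1).div_const (4 * K)
    have h3 := h1.sub h2
    refine h3.congr_deriv ?_
    rw [hφ'def]
    field_simp
    ring
  have hφ'nn : ∀ s ∈ Ico 0 t, 0 ≤ φ' s := by
    intro s hs
    have hsT : s ∈ Ico 0 T := ⟨hs.1, hs.2.trans_le ht.2⟩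
    have hnum : 0 ≤ -2 * K * I s - I' s - (1 / 2) * I s ^ 2 := by linarith [hineq s hsT]
    exact mul_nonneg (exp_pos _).le (div_nonneg hnum (sq_nonneg _))
  have hφcont : ContinuousOn φ (Icc 0 t) := by
    have hIc : ContinuousOn I (Icc 0 t) := hcont.mono (Icc_subset_Icc le_rfl ht.2)
    have hEc : Continuous fun x : ℝ ↦ exp (-2 * K * x) := by fun_prop
    refine (hEc.continuousOn.mul (hIc.inv₀ fun s hs ↦ (hIpos s hs).ne')).sub ?_
    exact (continuous_const.sub hEc).continuousOn.div_const _
  have hmono := image_le_of_deriv_right_le_deriv_boundary (f := fun _ ↦ φ 0) (f' := fun _ ↦ 0)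
    (a := 0) (b := t) continuousOn_const (fun x _ ↦ hasDerivWithinAt_const x (Ici x) (φ 0))
    (le_refl (φ 0)) hφcont hφder (fun x hx ↦ hφ'nn x hx)
  have hφ0t : φ 0 ≤ φ t := hmono ⟨ht.1, le_rfl⟩
  -- unfold `φ 0 = 1/I₀` and `φ t = e/I(t) - (1-e)/(4K)`
  have hφ0 : φ 0 = I₀⁻¹ := by
    simp [hφdef, hI₀def]
  have hφt : φ t = e * (I t)⁻¹ - (1 - e) / (4 * K) := by
    simp [hφdef, hedef]
  rw [hφ0, hφt] at hφ0t
  -- rearrange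
  set D : ℝ := I₀⁻¹ + (1 - e) / (4 * K) with hDdef
  have hDpos : 0 < D := by
    have : 0 ≤ (1 - e) / (4 * K) := div_nonneg (by linarith) (by positivity)
    have : 0 < I₀⁻¹ := inv_pos.2 hI₀pos
    linarith
  have hD_le : D ≤ e * (I t)⁻¹ := by
    rw [hDdef]
    linarith
  have hD_le' : D ≤ e / I t := by rwa [div_eq_mul_inv]
  have hmain : I t ≤ e / D := by
    rw [le_div_iff₀ hDpos]
    have := (le_div_iff₀ hIt).1 hD_le'
    linarith
  have hrewrite : e / D = 4 * K * I₀ * e / (4 * K + I₀ * (1 - e)) := by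
    rw [hDdef]
    field_simp
  rw [hrewrite] at hmain
  exact hmain

/-- **Integrated Riccati bound**: `∫₀ᵀ I ≤ 2 log (1 + I₀/(4K))`. -/
theorem integral_riccati_le {K : ℝ} (hK : 0 < K) {I I' : ℝ → ℝ} {T : ℝ} (hT : 0 ≤ T)
    (hcont : ContinuousOn I (Icc 0 T))
    (hder : ∀ t ∈ Ico 0 T, HasDerivWithinAt I (I' t) (Ici t) t)
    (hineq : ∀ t ∈ Ico 0 T, I' t ≤ -2 * K * I t - (1 / 2) * I t ^ 2)
    (hnn : ∀ t ∈ Icc 0 T, 0 ≤ I t) :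
    ∫ t in (0 : ℝ)..T, I t ≤ 2 * Real.log (1 + I 0 / (4 * K)) := by
  set I₀ : ℝ := I 0 with hI₀def
  have hI₀ : 0 ≤ I₀ := hnn 0 ⟨le_rfl, hT⟩
  set y : ℝ → ℝ := fun t ↦ 4 * K * I₀ * exp (-2 * K * t) / (4 * K + I₀ * (1 - exp (-2 * K * t)))
    with hydef
  set A : ℝ → ℝ := fun t ↦ 4 * K + I₀ * (1 - exp (-2 * K * t)) with hAdef
  set G : ℝ → ℝ := fun t ↦ 2 * Real.log (A t) with hGdef
  have hexp_le : ∀ t : ℝ, 0 ≤ t → exp (-2 * K * t) ≤ 1 := by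
    intro t ht
    rw [exp_le_one_iff]
    nlinarith
  have hApos : ∀ t : ℝ, 0 ≤ t → 0 < A t := by
    intro t ht
    have : 0 ≤ I₀ * (1 - exp (-2 * K * t)) := mul_nonneg hI₀ (by linarith [hexp_le t ht])
    simp only [hAdef]
    linarith
  have hexp : ∀ s : ℝ, HasDerivAt (fun x ↦ exp (-2 * K * x)) (exp (-2 * K * s) * (-2 * K)) s := by
    intro s
    have h := ((hasDerivAt_id s).const_mul (-2 * K)).exp
    simpa using h
  -- pointwise comparison
  have hpt : ∀ t ∈ Icc 0 T, I t ≤ y t := fun t ht ↦ by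
    simpa [hydef] using riccati_bound hK hT hcont hder hineq hnn ht
  -- continuity / integrability of `y` on `[0,T]`
  have hEc : Continuous fun x : ℝ ↦ exp (-2 * K * x) := by fun_prop
  have hAc : Continuous A := by
    simp only [hAdef]
    fun_prop
  have hyc : ContinuousOn y (Icc 0 T) := by
    simp only [hydef]
    refine ContinuousOn.div (by fun_prop) hAc.continuousOn ?_
    intro t ht
    exact (hApos t ht.1).ne'
  have hyint : IntervalIntegrable y MeasureTheory.volume 0 T := hyc.intervalIntegrable_of_Icc hT
  have hIint : IntervalIntegrable I MeasureTheory.volume 0 T := hcont.intervalIntegrable_of_Icc hT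
  have h1 : ∫ t in (0 : ℝ)..T, I t ≤ ∫ t in (0 : ℝ)..T, y t :=
    intervalIntegral.integral_mono_on hT hIint hyint hpt
  -- `G' = y` on `[0,T]`
  have hGder : ∀ t ∈ uIcc 0 T, HasDerivAt G (y t) t := by
    intro t ht
    rw [uIcc_of_le hT] at ht
    have hA' : HasDerivAt A (-(I₀ * (exp (-2 * K * t) * (-2 * K)))) t := by
      have h := ((hexp t).const_mul I₀).const_sub (4 * K + I₀)
      have hfun : (fun x ↦ 4 * K + I₀ - I₀ * exp (-2 * K * x)) = A := by
        funext x; simp only [hAdef]; ring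
      rw [hfun] at h
      exact h
    have hlog := ((Real.hasDerivAt_log (hApos t ht.1).ne').comp t hA').const_mul 2
    have hfun2 : (fun x ↦ 2 * (Real.log ∘ A) x) = G := by
      funext x; simp [hGdef]
    rw [hfun2] at hlog
    refine hlog.congr_deriv ?_
    have hAne : A t ≠ 0 := (hApos t ht.1).ne'
    simp only [hydef]
    have hAt : A t = 4 * K + I₀ * (1 - exp (-2 * K * t)) := by simp [hAdef]
    rw [hAt] at hAne ⊢
    field_simp
    ring
  have h2 : ∫ t in (0 : ℝ)..T, y t = G T - G 0 :=
    intervalIntegral.integral_eq_sub_of_hasDerivAt hGder hyint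
  -- evaluate and compare
  have hG0 : G 0 = 2 * Real.log (4 * K) := by
    simp [hGdef, hAdef]
  have hGT : G T ≤ 2 * Real.log (4 * K) + 2 * Real.log (1 + I₀ / (4 * K)) := by
    have h4K : 0 < 4 * K := by positivity
    have hAT : A T ≤ 4 * K * (1 + I₀ / (4 * K)) := by
      have hx : I₀ * (1 - exp (-2 * K * T)) ≤ I₀ :=
        by nlinarith [exp_pos (-2 * K * T), hI₀]
      have : 4 * K * (1 + I₀ / (4 * K)) = 4 * K + I₀ := by field_simp
      rw [this]
      simp only [hAdef]
      linarith
    have hlogle : Real.log (A T) ≤ Real.log (4 * K * (1 + I₀ / (4 * K))) :=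
      Real.log_le_log (hApos T hT) hAT
    have hsplit : Real.log (4 * K * (1 + I₀ / (4 * K))) = Real.log (4 * K) + Real.log (1 + I₀ / (4 * K)) := by
      rw [Real.log_mul h4K.ne' (by positivity)]
    simp only [hGdef]
    linarith
  calc ∫ t in (0 : ℝ)..T, I t ≤ ∫ t in (0 : ℝ)..T, y t := h1
    _ = G T - G 0 := h2
    _ ≤ 2 * Real.log (1 + I₀ / (4 * K)) := by rw [hG0]; linarith

end DrefuteRiccati

#print axioms DrefuteRiccati.integral_riccati_le
#print axioms DrefuteRiccati.riccati_bound
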